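import Summits.QuantumFields.YangMills.Theorems.BalabanUVNodesN19TiltedPriceVariation
import Summits.QuantumFields.YangMills.Theorems.BalabanUVNodesN19TiltedPriceTwoSided
import Mathlib.Analysis.SpecialFunctions.Trigonometric.Chebyshev.Basic

/-!
# YM-DAG node N19 (= NE7 proper) — THE TILTED PRICE ALONG THE WINDOW, II: Chebyshev alternation — the VARIATION price is `P(ε)`, two-sided

Cell `pub-ymgap`, HUMAN RULING D-0062 (Track A), R141 (C) wider-strategy seat `pub-ymgap-dag-n19-e` (strategy s3 = ALTERNATIVE CURRENCY), generation
g17, module 3 (sibling of `…N19TiltedPriceVariation`, filed right before: the MVT «linear somewhere» and the variation from ABOVE).  Route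
`Summits/QuantumFields/YangMills/Theses/BalabanUVNodes.lean` rev 25, cluster item K3⁷ «SpineGivenEndpointR13SepCoPH» (stmt-QuantumFields-20544, dag-lead
WORDS-143); filed `--supports` that item `--as helper` (it proves no registered stub).  COUNT-NEUTRAL: elementary, over Mathlib (`Polynomial.Chebyshev.T`,
`Chebyshev.T_real_cos`, `cos_nat_mul_pi`, `Measure.dirac`, `mgf` ∕ `cgf`) + the seat's modules BY NAME (p509390 `…NoLinearPriceWitness` Chebyshev bookkeeping,
p510514 `…NoLinearPrice.exists_lawPair_of_weights`, p517472 `one_add_le_mul_log_of_le`, p530176 `log_exp_one_add_posLog_le_two_mul`, the sibling's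
`sum_abs_cgf_increments_le_pi` ∕ `div_max_le_abs_log_increment`); no scheme object, no Theses import; NOT a discharge claim.

THE RESULT.  The sibling bounded the variation of `Δ = cgf_ν − cgf_μ` along any monotone family of sources in the closed window by `π·K`,
`K = 8e^{1+2e·l₀B}·ε(1+L₂)∕log(e+L₂)` — the expectation price `P`, integrated Bernstein.  Here the matching LOWER bound: p510514's grid-Chebyshev pair
(§1, re-derived with its evaluation identity `∑_j w_j e^{tj∕M} = ε·T_M(r⁻¹(e^{t∕M} − 1))`, `r = e^{l₀∕M} − 1`, displayed) EQUIOSCILLATES — at the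
`K + 1 = ⌊M∕2⌋ + 1` sources `s_i = M·log(1 + r·cos((K−i)π∕M)) ∈ [0, l₀]` (monotone in `i`; `r⁻¹(e^{s_i∕M} − 1) = cos((K−i)π∕M)` are Chebyshev's
alternation nodes) the mgf difference is `(−1)^{K−i}·ε` EXACTLY (§2 ★ `exists_mgf_close_alternating`; Mathlib `T_real_cos`: `T_M(cos θ) = cos(Mθ)`), so
each step costs the cgf difference `≥ e^{−l₀}ε` (§3, `div_max_le_abs_log_increment` with `mgf_μ ≤ e^{l₀}`) and the variation along the family is
`≥ K·e^{−2l₀}·(e^{l₀}ε)` (★ `exists_cgf_close_variation_ge`).  With `M ≳ (1+L)∕log(e+L)` along the family (p517472) this is `c(l₀)·P(ε)`: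
★★ `variation_price_two_sided` — for every window and every `ε₀` a pair with cgf's `ε`-close, `ε ≤ ε₀`, and a monotone source family with
`e^{−2l₀}∕(3(4+log(1+4∕l₀)))·P(ε) ≤ ∑|Δ(s_{i+1}) − Δ(s_i)| ≤ 16π·e^{1+2e·l₀}·P(ε)` (the upper half valid for EVERY pair and EVERY monotone family).
So: pointwise the price is linear SOMEWHERE in every sub-window (sibling §1), Bernstein ∕ Markov at worst (p528923 ∕ p530176 ∕ p539220), and in
VARIATION along the window exactly the expectation price `P(ε) = ε(1+L)∕log(e+L)` — the «degree» `n ≍ L∕log L` counted once, as the number of sign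
changes a degree-`n` exponential sum of size `ε` can afford on the window. [folklore: Chebyshev equioscillation, transported to the grid `{j∕M}`]

HONEST FRAMING (binding).  Elementary and [folklore]; NO consumer in the DAG today (value: completes the pricing of N19's currency along the window —
pointwise, in variation, two-sided); nothing of Bałaban's is instantiated; NE7 ∕ NE7b ∕ NE7c NOT PRINTED, NOT proved; N19 NOT discharged; count-neutral.
One finite `T⁴` programme at fixed `ε`; nothing continuum ∕ `ℝ⁴` ∕ OS ∕ mass-gap ∕ Clay.  0 `def` ∕ 0 `sorry`.
-/

noncomputable section

open Polynomial Real Finset MeasureTheory ProbabilityTheory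

namespace Summit.QuantumFields.YangMills.Theorems.BalabanUVNodesN19TiltedPriceVariationTwoSided

open Literature.MathematicalPhysics.QuantumFieldTheory.Balaban1983to89
open Summit.QuantumFields.YangMills.Theorems.BalabanUVNodesN19NoLinearPriceWitness
open Summit.QuantumFields.YangMills.Theorems.BalabanUVNodesN19NoLinearPrice
  (expsum_eq_eval abs_expm1_ratio_le_one exists_lawPair_of_weights abs_log_sub_log_le exp_neg_le_mgf_of_Icc ae_abs_le_one_of_Icc)
open Summit.QuantumFields.YangMills.Theorems.BalabanUVNodesN19SharpPriceTwoSided (one_add_le_mul_log_of_le)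
open Summit.QuantumFields.YangMills.Theorems.BalabanUVNodesN19TiltedPriceTwoSided (log_exp_one_add_posLog_le_two_mul)
open Summit.QuantumFields.YangMills.BalabanUVNodes.N19MGFJoinConverse (posLog_inv_two_mul_le)
open Summit.QuantumFields.YangMills.Theorems.BalabanUVNodesN19TiltedPriceVariation
  (sum_abs_cgf_increments_le_pi div_max_le_abs_log_increment)

/-! ## §1 The grid-Chebyshev weights with their evaluation identity displayed [folklore] -/

/-- p510514's Chebyshev exponential-sum witness (`exists_expsum_witness`: `w_j = (2∕Λ)[uʲ]T_M((u−1)∕r)`, `r = e^{l₀∕M} − 1`, odd `M`) re-derived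
with the EVALUATION IDENTITY `∑_j w_j e^{tj∕M} = ε·T_M(r⁻¹(e^{t∕M} − 1))` at EVERY real `t` displayed (p510514 exported only the window bound and the
value at `t = l₀`); mass `0`, total variation `2`, `2(1 + 4M∕l₀)^{−M} ≤ ε ≤ 4(l₀e^{l₀}∕(2M))^M`, `|∑_j w_j e^{tj∕M}| ≤ ε` on `|t| ≤ l₀` as there. [folklore] -/
theorem exists_expsum_witness_eval {l₀ : ℝ} (hl₀ : 0 < l₀) {M : ℕ} (hM : Odd M) :
    ∃ (w : ℕ → ℝ) (ε : ℝ), 0 < ε ∧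
      ∑ j ∈ range (M + 1), w j = 0 ∧ ∑ j ∈ range (M + 1), |w j| = 2 ∧
      2 / (1 + 4 * M / l₀) ^ M ≤ ε ∧ ε ≤ 4 * (l₀ * exp l₀ / (2 * M)) ^ M ∧
      (∀ t : ℝ, |t| ≤ l₀ → |∑ j ∈ range (M + 1), w j * exp (t * j / M)| ≤ ε) ∧
      ∀ t : ℝ, ∑ j ∈ range (M + 1), w j * exp (t * j / M) =
        ε * (Chebyshev.T ℝ (M : ℤ)).eval ((exp (l₀ / M) - 1)⁻¹ * (exp (t / M) - 1)) := by
  have hM0 : 0 < M := hM.pos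
  have hMr : (0 : ℝ) < M := Nat.cast_pos.mpr hM0
  have hM1 : (1 : ℝ) ≤ M := by exact_mod_cast hM0
  have ha0 : 0 < l₀ / M := div_pos hl₀ hMr
  set r : ℝ := exp (l₀ / M) - 1 with hr_def
  have hra : l₀ / M ≤ r := by
    have := Real.add_one_le_exp (l₀ / M)
    rw [hr_def]
    linarith
  have hr0 : 0 < r := lt_of_lt_of_le ha0 hra
  have hal : l₀ / M ≤ l₀ := div_le_self hl₀.le hM1
  have hr_le : r ≤ l₀ * exp l₀ / M := by
    calc r ≤ l₀ / M * exp (l₀ / M) := Literature.Analysis.ODE.exp_sub_one_le_mul_exp _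
      _ ≤ l₀ / M * exp l₀ := mul_le_mul_of_nonneg_left (exp_le_exp.mpr hal) ha0.le
      _ = l₀ * exp l₀ / M := by ring
  set P : ℝ[X] := (Chebyshev.T ℝ M).comp (C r⁻¹ * (X - C 1)) with hP
  have hPdeg : P.natDegree < M + 1 := by
    rw [hP, natDegree_chebAff hr0.ne']
    exact Nat.lt_succ_self M
  set Λ : ℝ := ∑ j ∈ range (M + 1), |P.coeff j| with hΛ
  have hΛlo : 2 ^ (M - 1) * r⁻¹ ^ M ≤ Λ := pow_le_sum_abs_coeff_chebAff hr0 M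
  have hΛhi : Λ ≤ (1 + 4 / r) ^ M := sum_abs_coeff_chebAff_le hr0 M M le_rfl
  have hlead : 0 < (2 : ℝ) ^ (M - 1) * r⁻¹ ^ M := by positivity
  have hΛ0 : 0 < Λ := lt_of_lt_of_le hlead hΛlo
  have hc0 : 0 < 2 / Λ := by positivity
  have hsum : ∀ g : ℕ → ℝ, ∑ j ∈ range (M + 1), 2 / Λ * P.coeff j * g j =
      2 / Λ * ∑ j ∈ range (M + 1), P.coeff j * g j := by
    intro g
    rw [mul_sum]
    exact sum_congr rfl fun j _ => mul_assoc _ _ _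
  refine ⟨fun j => 2 / Λ * P.coeff j, 2 / Λ, hc0, ?_, ?_, ?_, ?_, ?_, ?_⟩
  · -- equal mass
    rw [← mul_sum, hP, sum_coeff_chebAff_eq_zero hr0.ne' hM, mul_zero]
  · -- total variation `2`
    have : ∀ j, |2 / Λ * P.coeff j| = 2 / Λ * |P.coeff j| := fun j => by
      rw [abs_mul, abs_of_pos hc0]
    simp_rw [this]
    rw [← mul_sum, ← hΛ, div_mul_cancel₀ _ hΛ0.ne']
  · -- `ε` from below
    rw [div_le_div_iff_of_pos_left two_pos (by positivity) hΛ0]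
    refine hΛhi.trans (pow_le_pow_left₀ (by positivity) ?_ M)
    have h4 : 4 / r ≤ 4 * M / l₀ := by
      rw [mul_div_assoc, div_eq_mul_inv 4 r]
      refine mul_le_mul_of_nonneg_left ?_ (by norm_num)
      calc r⁻¹ ≤ (l₀ / M)⁻¹ := by rw [inv_le_inv₀ hr0 ha0]; exact hra
        _ = M / l₀ := by rw [inv_div]
    linarith
  · -- `ε` from above
    calc 2 / Λ ≤ 2 / (2 ^ (M - 1) * r⁻¹ ^ M) := div_le_div_of_nonneg_left zero_le_two hlead hΛlo
      _ = 4 * (r / 2) ^ M := by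
          obtain ⟨k, rfl⟩ := Nat.exists_eq_add_of_le' hM0
          rw [Nat.add_sub_cancel, div_pow, inv_pow, pow_succ (2 : ℝ) k]
          field_simp
          ring
      _ ≤ 4 * (l₀ * exp l₀ / (2 * M)) ^ M := by
          gcongr 4 * ?_ ^ M
          calc r / 2 ≤ l₀ * exp l₀ / M / 2 := by gcongr
            _ = l₀ * exp l₀ / (2 * M) := by ring
  · -- the window bound
    intro t ht
    rw [hsum, expsum_eq_eval P hPdeg M t, abs_mul, abs_of_pos hc0]
    refine mul_le_of_le_one_right hc0.le ?_
    rw [hP]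
    exact abs_eval_chebAff_le_one r M (by rw [hr_def]; exact abs_expm1_ratio_le_one hl₀ hM0 ht)
  · -- the evaluation identity
    intro t
    rw [hsum, expsum_eq_eval P hPdeg M t, hP, eval_chebAff]

/-! ## §2 Chebyshev alternation along the window: two laws whose mgf difference equioscillates [folklore] -/

/-- **★ TWO LAWS ON `[0, 1]` WHOSE MGF DIFFERENCE EQUIOSCILLATES ALONG `[0, l₀]`.**  For `0 < l₀` and odd `M`: probability laws `μ, ν` on `[0,1]`
(§1's weights through p510514's `exists_lawPair_of_weights`) with `|mgf_ν − mgf_μ| ≤ ε` on `|t| ≤ l₀`, `2(1+4M∕l₀)^{−M} ≤ ε ≤ 4(l₀e^{l₀}∕(2M))^M`, and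
a MONOTONE family of sources `s_i = M·log(1 + r·cos((K − i)π∕M)) ∈ [0, l₀]`, `K = ⌊M∕2⌋`, `r = e^{l₀∕M} − 1` (so `r⁻¹(e^{s_i∕M} − 1) = cos((K−i)π∕M)`,
Chebyshev nodes of ALTERNATION; `s_i = l₀` for `i ≥ K`), along which `mgf_ν(s_i) − mgf_μ(s_i) = (−1)^{K−i}·ε` for `i ≤ K`
(Mathlib `Chebyshev.T_real_cos`: `T_M(cos θ) = cos(Mθ)`, and `cos(kπ) = (−1)^k`). [folklore: Chebyshev's equioscillation] -/
theorem exists_mgf_close_alternating {l₀ : ℝ} (hl₀ : 0 < l₀) {M : ℕ} (hM : Odd M) :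
    ∃ μ ν : Measure ℝ, IsProbabilityMeasure μ ∧ IsProbabilityMeasure ν ∧
      μ (Set.Icc 0 1)ᶜ = 0 ∧ ν (Set.Icc 0 1)ᶜ = 0 ∧
      ∃ ε : ℝ, 0 < ε ∧ 2 / (1 + 4 * M / l₀) ^ M ≤ ε ∧ ε ≤ 4 * (l₀ * exp l₀ / (2 * M)) ^ M ∧
        (∀ t : ℝ, |t| ≤ l₀ → |mgf id ν t - mgf id μ t| ≤ ε) ∧
        ∃ s : ℕ → ℝ, Monotone s ∧ (∀ i, 0 ≤ s i ∧ s i ≤ l₀) ∧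
          ∀ i, i ≤ M / 2 → mgf id ν (s i) - mgf id μ (s i) = (-1) ^ (M / 2 - i) * ε := by
  have hM0 : 0 < M := hM.pos
  have hMr : (0 : ℝ) < M := Nat.cast_pos.mpr hM0
  obtain ⟨w, ε, hε, h0, h2, hlo, hhi, hwin, heval⟩ := exists_expsum_witness_eval hl₀ hM
  obtain ⟨μ, ν, iμ, iν, hμ, hν, hg⟩ := exists_lawPair_of_weights w h0 h2
  have hmgf : ∀ t : ℝ, mgf id ν t - mgf id μ t = ∑ j ∈ range (M + 1), w j * exp (t * j / M) := by
    intro t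
    simp only [mgf, id]
    rw [hg fun x => exp (t * x)]
    refine sum_congr rfl fun j _ => ?_
    rw [mul_div_assoc]
  -- the radius and the alternation sources
  set r : ℝ := exp (l₀ / M) - 1 with hr_def
  have ha0 : 0 < l₀ / M := div_pos hl₀ hMr
  have hr0 : 0 < r := by
    have := Real.add_one_lt_exp ha0.ne'
    rw [hr_def]; linarith
  set θ : ℕ → ℝ := fun i => ((M / 2 - i : ℕ) : ℝ) * π / M with hθ
  have hθ0 : ∀ i, 0 ≤ θ i := fun i => by positivity
  have hθpi : ∀ i, θ i ≤ π / 2 := fun i => by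
    have hk : ((M / 2 - i : ℕ) : ℝ) ≤ M / 2 := by
      calc ((M / 2 - i : ℕ) : ℝ) ≤ ((M / 2 : ℕ) : ℝ) := by exact_mod_cast Nat.sub_le _ _
        _ ≤ M / 2 := Nat.cast_div_le
    rw [hθ]
    show ((M / 2 - i : ℕ) : ℝ) * π / M ≤ π / 2
    rw [div_le_div_iff₀ hMr two_pos]
    nlinarith [Real.pi_pos]
  have hcos0 : ∀ i, 0 ≤ cos (θ i) := fun i =>
    cos_nonneg_of_neg_pi_div_two_le_of_le (by linarith [hθ0 i, Real.pi_pos]) (hθpi i)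
  have hcos1 : ∀ i, cos (θ i) ≤ 1 := fun i => cos_le_one _
  set s : ℕ → ℝ := fun i => M * Real.log (1 + r * cos (θ i)) with hs
  have hin : ∀ i, 1 ≤ 1 + r * cos (θ i) := fun i => by nlinarith [hcos0 i, hr0]
  have hin' : ∀ i, 1 + r * cos (θ i) ≤ exp (l₀ / M) := fun i => by
    rw [hr_def]; nlinarith [hcos1 i, hr0]
  refine ⟨μ, ν, iμ, iν, hμ, hν, ε, hε, hlo, hhi, fun t ht => by rw [hmgf]; exact hwin t ht, s, ?_, ?_, ?_⟩
  · -- monotone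
    intro i j hij
    have hθij : θ j ≤ θ i := by
      rw [hθ]
      show ((M / 2 - j : ℕ) : ℝ) * π / M ≤ ((M / 2 - i : ℕ) : ℝ) * π / M
      have : ((M / 2 - j : ℕ) : ℝ) ≤ ((M / 2 - i : ℕ) : ℝ) := by exact_mod_cast Nat.sub_le_sub_left hij _
      exact div_le_div_of_nonneg_right (mul_le_mul_of_nonneg_right this Real.pi_pos.le) hMr.le
    have hc : cos (θ i) ≤ cos (θ j) :=
      cos_le_cos_of_nonneg_of_le_pi (hθ0 j) (by linarith [hθpi i, Real.pi_pos]) hθij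
    show M * Real.log (1 + r * cos (θ i)) ≤ M * Real.log (1 + r * cos (θ j))
    refine mul_le_mul_of_nonneg_left (Real.log_le_log (by linarith [hin i]) (by nlinarith [hr0])) hMr.le
  · -- inside `[0, l₀]`
    intro i
    refine ⟨mul_nonneg hMr.le (Real.log_nonneg (hin i)), ?_⟩
    calc (M : ℝ) * Real.log (1 + r * cos (θ i)) ≤ M * (l₀ / M) := by
          refine mul_le_mul_of_nonneg_left ?_ hMr.le
          rw [← Real.log_exp (l₀ / M)]
          exact Real.log_le_log (by linarith [hin i]) (hin' i)
      _ = l₀ := by field_simp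
  · -- alternation
    intro i hi
    have hpos : 0 < 1 + r * cos (θ i) := by linarith [hin i]
    have hexp : exp (s i / M) = 1 + r * cos (θ i) := by
      show exp (M * Real.log (1 + r * cos (θ i)) / M) = _
      rw [mul_div_cancel_left₀ _ hMr.ne']
      exact Real.exp_log hpos
    rw [hmgf, heval (s i), hexp, add_sub_cancel_left, ← mul_assoc, inv_mul_cancel₀ hr0.ne', one_mul,
      Polynomial.Chebyshev.T_real_cos, mul_comm]
    congr 1
    rw [hθ]
    show cos (((M : ℤ) : ℝ) * (((M / 2 - i : ℕ) : ℝ) * π / M)) = (-1) ^ (M / 2 - i)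
    rw [Int.cast_natCast, show (M : ℝ) * (((M / 2 - i : ℕ) : ℝ) * π / M) = ((M / 2 - i : ℕ) : ℝ) * π by field_simp,
      cos_nat_mul_pi]

/-! ## §3 The variation from BELOW along the alternation, and the two-sided statement -/

/-- **★ THE VARIATION FROM BELOW (explicit family).**  For `0 < l₀` and odd `M`: two probability laws on `[0, 1]` with cgf's `ε`-close on `|t| ≤ l₀`,
`e^{l₀}·2(1+4M∕l₀)^{−M} ≤ ε ≤ e^{l₀}·4(l₀e^{l₀}∕(2M))^M`, and a monotone family of `K + 1` sources in `[0, l₀]`, `K = ⌊M∕2⌋` (§2), along which the cgf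
difference has variation `∑_{i<K} |Δ(s_{i+1}) − Δ(s_i)| ≥ K·e^{−2l₀}·ε`: consecutive sources see mgf differences `±e^{−l₀}ε·e^{…}` of OPPOSITE signs,
and each alternation costs `≥ ε_mgf∕max mgf_μ ≥ e^{−2l₀}ε` (`mgf ≤ e^{l₀}` on the window for laws on `[0,1]`). [folklore] -/
theorem exists_cgf_close_variation_ge {l₀ : ℝ} (hl₀ : 0 < l₀) {M : ℕ} (hM : Odd M) :
    ∃ μ ν : Measure ℝ, IsProbabilityMeasure μ ∧ IsProbabilityMeasure ν ∧
      μ (Set.Icc 0 1)ᶜ = 0 ∧ ν (Set.Icc 0 1)ᶜ = 0 ∧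
      ∃ ε : ℝ, 0 < ε ∧ exp l₀ * (2 / (1 + 4 * M / l₀) ^ M) ≤ ε ∧ ε ≤ exp l₀ * (4 * (l₀ * exp l₀ / (2 * M)) ^ M) ∧
        (∀ t : ℝ, |t| ≤ l₀ → |cgf id ν t - cgf id μ t| ≤ ε) ∧
        ∃ s : ℕ → ℝ, Monotone s ∧ (∀ i, 0 ≤ s i ∧ s i ≤ l₀) ∧
          (M / 2 : ℕ) * (exp (-2 * l₀) * ε) ≤
            ∑ i ∈ range (M / 2), |(cgf id ν (s (i + 1)) - cgf id μ (s (i + 1))) - (cgf id ν (s i) - cgf id μ (s i))| := by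
  obtain ⟨μ, ν, iμ, iν, hμ, hν, ε, hε, hlo, hhi, hwin, s, hs, hsI, halt⟩ := exists_mgf_close_alternating hl₀ hM
  have hm : 0 < exp (-l₀) := exp_pos _
  -- mgf's of laws on `[0,1]` on the window: `e^{−l₀} ≤ mgf ≤ e^{l₀}`
  have hup : ∀ (κ : Measure ℝ) [IsProbabilityMeasure κ], κ (Set.Icc 0 1)ᶜ = 0 → ∀ t : ℝ, |t| ≤ l₀ → mgf id κ t ≤ exp l₀ := by
    intro κ _ hκ t ht
    have h := T4GenFunBounds.mgf_le_of_abs_le (μ := κ) (X := id) (ae_abs_le_one_of_Icc hκ) t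
    rw [probReal_univ, one_mul, mul_one] at h
    exact h.trans (exp_le_exp.2 ht)
  have hsabs : ∀ i, |s i| ≤ l₀ := fun i => abs_le.2 ⟨by linarith [(hsI i).1], (hsI i).2⟩
  refine ⟨μ, ν, iμ, iν, hμ, hν, exp l₀ * ε, by positivity, mul_le_mul_of_nonneg_left hlo (exp_pos _).le,
    mul_le_mul_of_nonneg_left hhi (exp_pos _).le, fun t ht => ?_, s, hs, hsI, ?_⟩
  · calc |cgf id ν t - cgf id μ t| ≤ |mgf id ν t - mgf id μ t| / exp (-l₀) :=
          abs_log_sub_log_le hm (exp_neg_le_mgf_of_Icc hν ht) (exp_neg_le_mgf_of_Icc hμ ht)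
      _ ≤ ε / exp (-l₀) := div_le_div_of_nonneg_right (hwin t ht) hm.le
      _ = exp l₀ * ε := by rw [Real.exp_neg, div_inv_eq_mul, mul_comm]
  · -- each of the `K` increments is `≥ e^{−2l₀}·(e^{l₀}ε) = e^{−l₀}ε`
    have hstep : ∀ i ∈ range (M / 2), exp (-2 * l₀) * (exp l₀ * ε) ≤
        |(cgf id ν (s (i + 1)) - cgf id μ (s (i + 1))) - (cgf id ν (s i) - cgf id μ (s i))| := by
      intro i hi
      have hiK : i + 1 ≤ M / 2 := mem_range.1 hi
      have hPQ : ∀ j, 0 < mgf id μ (s j) ∧ 0 < mgf id ν (s j) := fun j =>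
        ⟨lt_of_lt_of_le hm (exp_neg_le_mgf_of_Icc hμ (hsabs j)), lt_of_lt_of_le hm (exp_neg_le_mgf_of_Icc hν (hsabs j))⟩
      set σ : ℝ := (-1) ^ (M / 2 - (i + 1)) with hσ
      have hσ1 : σ = 1 ∨ σ = -1 := neg_one_pow_eq_or ℝ _
      have h2 : mgf id ν (s (i + 1)) - mgf id μ (s (i + 1)) = σ * ε := halt (i + 1) hiK
      have h1 : mgf id ν (s i) - mgf id μ (s i) = -σ * ε := by
        rw [halt i (Nat.le_of_succ_le hiK), hσ, show M / 2 - i = M / 2 - (i + 1) + 1 by omega, pow_succ]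
        ring
      have hkey := div_max_le_abs_log_increment (hPQ i).1 (hPQ (i + 1)).1 (hPQ i).2 (hPQ (i + 1)).2 hε.le hσ1 h1 h2
      simp only [cgf]
      refine le_trans ?_ hkey
      have hmax : max (mgf id μ (s i)) (mgf id μ (s (i + 1))) ≤ exp l₀ :=
        max_le (hup μ hμ _ (hsabs i)) (hup μ hμ _ (hsabs (i + 1)))
      have hmax0 : 0 < max (mgf id μ (s i)) (mgf id μ (s (i + 1))) := lt_max_of_lt_left (hPQ i).1
      calc exp (-2 * l₀) * (exp l₀ * ε) = ε / exp l₀ := by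
            rw [show (-2 : ℝ) * l₀ = -l₀ + -l₀ by ring, Real.exp_add, Real.exp_neg]
            field_simp
        _ ≤ ε / max (mgf id μ (s i)) (mgf id μ (s (i + 1))) := div_le_div_of_nonneg_left hε.le hmax0 hmax
    calc ((M / 2 : ℕ) : ℝ) * (exp (-2 * l₀) * (exp l₀ * ε))
        = ∑ i ∈ range (M / 2), exp (-2 * l₀) * (exp l₀ * ε) := by rw [sum_const, card_range, nsmul_eq_mul]
      _ ≤ _ := sum_le_sum hstep

/-- **★★ THE WINDOW-VARIATION PRICE IS `P(ε) = ε(1+L)∕log(e+L)`, TWO-SIDED.**  For every window `0 < l₀` and every `ε₀ > 0` there are two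
probability laws `μ, ν` on `[0, 1]` and `0 < ε ≤ ε₀` with cgf's `ε`-close on `|t| ≤ l₀`, and a monotone family of sources `s_0 ≤ s_1 ≤ … ` in `[0, l₀]`
with `m` steps, such that
`c(l₀)·P(ε) ≤ ∑_{i<m} |Δ(s_{i+1}) − Δ(s_i)| ≤ C(l₀)·P(ε)`, `Δ = cgf_ν − cgf_μ`, `c(l₀) = e^{−2l₀}∕(3(4 + log(1 + 4∕l₀)))`, `C(l₀) = 16π·e^{1+2e·l₀}`
— lower half `exists_cgf_close_variation_ge` at a large odd `M` (`K = (M−1)∕2 ≥ M∕3`; `M ≳ (1+L)∕log(e+L)` by p517472's `one_add_le_mul_log_of_le`),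
upper half the sibling's `sum_abs_cgf_increments_le_pi` (valid for EVERY pair and EVERY monotone family; `B = 1`, `c = 0`) after p530176's `log` trade
(`L₂ ≤ L`, `log(e+L) ≤ 2log(e+L₂)`).  The expectation price `P` — not Bernstein's `P∕√(l₀²−s²)`, not Markov's `P₂` — governs the window in the
mean, although (sibling §1) at SOME source of every sub-window the price is linear. [folklore] -/
theorem variation_price_two_sided {l₀ : ℝ} (hl₀ : 0 < l₀) {ε₀ : ℝ} (hε₀ : 0 < ε₀) :
    ∃ μ ν : Measure ℝ, IsProbabilityMeasure μ ∧ IsProbabilityMeasure ν ∧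
      μ (Set.Icc 0 1)ᶜ = 0 ∧ ν (Set.Icc 0 1)ᶜ = 0 ∧
      ∃ ε : ℝ, 0 < ε ∧ ε ≤ ε₀ ∧ (∀ t : ℝ, |t| ≤ l₀ → |cgf id ν t - cgf id μ t| ≤ ε) ∧
        ∃ (s : ℕ → ℝ) (m : ℕ), Monotone s ∧ (∀ i, 0 ≤ s i ∧ s i ≤ l₀) ∧
          Real.exp (-2 * l₀) / (3 * (4 + Real.log (1 + 4 / l₀))) *
              (ε * (1 + Real.posLog ε⁻¹) / Real.log (Real.exp 1 + Real.posLog ε⁻¹)) ≤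
            ∑ i ∈ range m, |(cgf id ν (s (i + 1)) - cgf id μ (s (i + 1))) - (cgf id ν (s i) - cgf id μ (s i))| ∧
          ∑ i ∈ range m, |(cgf id ν (s (i + 1)) - cgf id μ (s (i + 1))) - (cgf id ν (s i) - cgf id μ (s i))| ≤
            16 * π * Real.exp (1 + 2 * Real.exp 1 * l₀) *
              (ε * (1 + Real.posLog ε⁻¹) / Real.log (Real.exp 1 + Real.posLog ε⁻¹)) := by
  -- a large odd `M = 2k + 1`
  set a : ℝ := l₀ * Real.exp l₀ with ha
  have ha0 : 0 < a := by positivity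
  obtain ⟨k, hk⟩ := exists_nat_gt (max (max a (2 * a * Real.exp l₀ / ε₀)) 1)
  have hka : a < k := ((le_max_left _ _).trans (le_max_left _ _)).trans_lt hk
  have hkε : 2 * a * Real.exp l₀ / ε₀ < k := ((le_max_right _ _).trans (le_max_left _ _)).trans_lt hk
  have hk1 : (1 : ℝ) < k := (le_max_right _ _).trans_lt hk
  have hk0 : (0 : ℝ) < k := ha0.trans hka
  set M : ℕ := 2 * k + 1 with hMdef
  have hModd : Odd M := odd_two_mul_add_one k
  have hMk : (k : ℝ) < M := by rw [hMdef]; push_cast; linarith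
  have hM0 : (0 : ℝ) < M := hk0.trans hMk
  have hM1 : 1 ≤ M := hModd.pos
  have hK : M / 2 = k := by omega
  obtain ⟨μ, ν, iμ, iν, hμ, hν, ε, hε, hlo, hhi, hwin, s, hs, hsI, hlow⟩ := exists_cgf_close_variation_ge hl₀ hModd
  -- `ε ≤ ε₀`
  have hb0 : 0 ≤ a / (2 * M) := div_nonneg ha0.le (by positivity)
  have hb1 : a / (2 * M) ≤ 1 := by
    rw [div_le_one (by positivity)]
    linarith
  have hεsmall : ε ≤ ε₀ := by
    have h1 : (a / (2 * M)) ^ M ≤ a / (2 * M) := by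
      calc (a / (2 * M)) ^ M ≤ (a / (2 * M)) ^ 1 := pow_le_pow_of_le_one hb0 hb1 (by exact_mod_cast hM1)
        _ = a / (2 * M) := pow_one _
    have h2 : ε ≤ 2 * a * Real.exp l₀ / M :=
      calc ε ≤ Real.exp l₀ * (4 * (a / (2 * M)) ^ M) := by rw [ha]; exact hhi
        _ ≤ Real.exp l₀ * (4 * (a / (2 * M))) := by gcongr
        _ = 2 * a * Real.exp l₀ / M := by field_simp; ring
    have h3 : 2 * a * Real.exp l₀ / M ≤ 2 * a * Real.exp l₀ / k :=
      div_le_div_of_nonneg_left (mul_pos (mul_pos two_pos ha0) (Real.exp_pos _)).le hk0 hMk.le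
    have h4 : 2 * a * Real.exp l₀ / k < ε₀ := by
      rw [div_lt_iff₀ hk0]
      have := (div_lt_iff₀ hε₀).1 hkε
      linarith
    linarith
  refine ⟨μ, ν, iμ, iν, hμ, hν, ε, hε, hεsmall, hwin, s, M / 2, hs, hsI, ?_, ?_⟩
  · -- the lower half: `K·e^{−2l₀}ε` with `K = k ≥ M∕3` and `M ≥ (1+L)∕((4+log(1+4∕l₀))·log(e+L))`
    refine le_trans ?_ hlow
    set L := Real.posLog ε⁻¹ with hL
    have hL0 : 0 ≤ L := Real.posLog_nonneg
    have hbase : 1 ≤ 1 + 4 * (M : ℝ) / l₀ := by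
      have : 0 ≤ 4 * (M : ℝ) / l₀ := by positivity
      linarith
    have hpow1 : 1 ≤ (1 + 4 * (M : ℝ) / l₀) ^ M := one_le_pow₀ hbase
    have hinv : ε⁻¹ ≤ (1 + 4 * (M : ℝ) / l₀) ^ M := by
      rw [inv_le_comm₀ hε (by positivity)]
      calc ((1 + 4 * (M : ℝ) / l₀) ^ M)⁻¹ = 1 * (1 / (1 + 4 * (M : ℝ) / l₀) ^ M) := by rw [one_mul, one_div]
        _ ≤ Real.exp l₀ * (2 / (1 + 4 * (M : ℝ) / l₀) ^ M) := by
            gcongr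
            · exact Real.one_le_exp hl₀.le
            · norm_num
        _ ≤ ε := hlo
    have hLle : L ≤ M * Real.log (1 + 4 * M / l₀) := by
      calc L = Real.posLog ε⁻¹ := hL
        _ ≤ Real.posLog ((1 + 4 * (M : ℝ) / l₀) ^ M) :=
            Real.monotoneOn_posLog (Set.mem_Ici.2 (inv_nonneg.2 hε.le)) (Set.mem_Ici.2 (by positivity)) hinv
        _ = Real.log ((1 + 4 * (M : ℝ) / l₀) ^ M) :=
            Real.posLog_eq_log (by rwa [abs_of_nonneg (by positivity)])
        _ = M * Real.log (1 + 4 * M / l₀) := by rw [Real.log_pow]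
    have harith := one_add_le_mul_log_of_le hl₀ hM1 hL0 hLle
    have hc : 0 < 4 + Real.log (1 + 4 / l₀) := by
      have : 0 ≤ Real.log (1 + 4 / l₀) := Real.log_nonneg (by linarith [div_pos four_pos hl₀])
      linarith
    have hlogpos : 0 < Real.log (Real.exp 1 + L) := by
      have : 1 ≤ Real.log (Real.exp 1 + L) := by
        rw [Real.le_log_iff_exp_le (by positivity)]
        linarith
      linarith
    have hKM : (M : ℝ) ≤ 3 * ((M / 2 : ℕ) : ℝ) := by
      rw [hK, hMdef]; push_cast; linarith
    generalize hcdef : 4 + Real.log (1 + 4 / l₀) = c at hc harith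
    generalize hgdef : Real.log (Real.exp 1 + L) = g at hlogpos harith
    calc Real.exp (-2 * l₀) / (3 * c) * (ε * (1 + L) / g)
        ≤ Real.exp (-2 * l₀) / (3 * c) * (ε * (c * M * g) / g) := by gcongr
      _ = M / 3 * (Real.exp (-2 * l₀) * ε) := by field_simp
      _ ≤ ((M / 2 : ℕ) : ℝ) * (Real.exp (-2 * l₀) * ε) := by
          refine mul_le_mul_of_nonneg_right ?_ (by positivity)
          linarith
  · -- the upper half: the sibling's bound at `B = 1`, `c = 0`, then the `log` trade
    have hwin0 : ∀ u : ℝ, |u| ≤ l₀ → |cgf id ν u - cgf id μ u - 0| ≤ ε := fun u hu => by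
      rw [sub_zero]; exact hwin u hu
    have hup := sum_abs_cgf_increments_le_pi (ν := μ) (ν' := ν) (F := id) (F' := id) (B := 1)
      aemeasurable_id (ae_abs_le_one_of_Icc hμ) aemeasurable_id (ae_abs_le_one_of_Icc hν) hl₀ hε.le hwin0 hs
      (m := M / 2) (by linarith [(hsI 0).1]) (hsI (M / 2)).2
    refine hup.trans ?_
    set L := Real.posLog ε⁻¹ with hL
    set L₂ := Real.posLog (2 * ε)⁻¹ with hL₂
    have hL0 : 0 ≤ L := Real.posLog_nonneg
    have hL₂0 : 0 ≤ L₂ := Real.posLog_nonneg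
    have hL₂L : L₂ ≤ L := posLog_inv_two_mul_le hε.le
    have hlog2 : Real.log (Real.exp 1 + L) ≤ 2 * Real.log (Real.exp 1 + L₂) := log_exp_one_add_posLog_le_two_mul hε
    have hlogpos : 0 < Real.log (Real.exp 1 + L) := Real.log_pos (by linarith [Real.exp_one_gt_d9])
    have hlog₂pos : 0 < Real.log (Real.exp 1 + L₂) := Real.log_pos (by linarith [Real.exp_one_gt_d9])
    rw [mul_one]
    calc π * (8 * Real.exp (1 + 2 * Real.exp 1 * l₀) * ε * (1 + L₂) / Real.log (Real.exp 1 + L₂))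
        = 8 * π * Real.exp (1 + 2 * Real.exp 1 * l₀) * (ε * (1 + L₂)) * (1 / Real.log (Real.exp 1 + L₂)) := by
          field_simp
      _ ≤ 8 * π * Real.exp (1 + 2 * Real.exp 1 * l₀) * (ε * (1 + L)) * (2 / Real.log (Real.exp 1 + L)) := by
          gcongr 8 * π * Real.exp (1 + 2 * Real.exp 1 * l₀) * (ε * (1 + ?_)) * ?_
          rw [div_le_div_iff₀ hlog₂pos hlogpos]
          linarith
      _ = 16 * π * Real.exp (1 + 2 * Real.exp 1 * l₀) * (ε * (1 + L) / Real.log (Real.exp 1 + L)) := by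
          field_simp
          ring

end Summit.QuantumFields.YangMills.Theorems.BalabanUVNodesN19TiltedPriceVariationTwoSided

end
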